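import Summits.KontsevichZagierPeriods.KontsevichZagierPeriods.Theses.HeckeMultiplicityOne
import Literature.NumberTheory.EllipticCurves.ModularSymbolRep
import Literature.NumberTheory.EllipticCurves.HeckeIntegralityProofs
import Literature.NumberTheory.Transcendental.KZSubcalculusInvariants
import Literature.NumberTheory.Transcendental.SemialgebraicMapsProofs

/-!
# `HeckeIsMoves` — Hecke correspondences are moves (stmt-KontsevichZagierPeriods-5125, route
`HeckeMultiplicityOne`, support item of rank 3), typed in the vocabulary of `ModularSymbolRep`

The route files the item informally ("HECKE CORRESPONDENCES ARE MOVES: for a newform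
`f ∈ S₂(Γ₀(N))` with rational Fourier coefficients, a prime `p` and a unimodular arc `g{0,∞}`,
`a_p(f)·[arc, ω_f] − Σᵢ [Mᵢ·arc, ω_f] ∈ KZ.relations`"), pending the definition request
`ModularSymbolRep`, which has since landed (`Literature/NumberTheory/EllipticCurves/ModularSymbolRep.lean`).
In that formalism every arc integral is a one-dimensional Kontsevich–Zagier representation on the
COMMON domain `arcDomain = (1728, ∞) ⊆ ℝ¹` (the coordinate `u = j` of the ORIGINAL half-arc
`g·{it | t > 1}`), with canonical integrand `arcIntegrand φ u = (2πi φ/j')(i t₊(u))` for the cusp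
function `φ = f ∣ g`; the `i`-th Hecke translate of the half-arc is the half-arc of the cusp function
`(f ∣ βᵢ) ∣ g`, `βᵢ ∈ {(1 j; 0 p) : j mod p} ∪ {diag(p, 1)}` (`heckeRep`, index set `HeckeIdx N p`,
Diamond–Shurman Prop. 5.2.1; Cremona (2.8.7)–(2.8.8) for the modular-symbol form), whose canonical
integrand is the pulled-back form `(ω_f/dj)(βᵢ g · i t₊(u)) · d(j ∘ βᵢ)/dj` — a function of the SAME
real variable `u`.  The pointwise trace identity `T_p ω_f = a_p ω_f` on the `u`-line is the tree's
`arcIntegrand_heckeT`.  Consequently the typed content of `HeckeIsMoves` is exactly ONE family of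
moves of the calculus: integrand additivity (rule (1b)) on the common domain, `p + 1` times, plus the
bookkeeping `[σ, a f] ≡ a • [σ, f]` for the INTEGER eigenvalue `a = a_p(f)` (again rule (1b),
`KZ.IntegralRep.of_constMul_nat_sub_nsmul_mem_relations`).  No change of variables is needed: the
card's "rule 2 along the branches `u ↦ uᵢ(u)` of `Φ_p(u, uᵢ) = 0`" is subsumed by the common
coordinate (and could not be a real change of variables anyway — on a non-unimodular image arc
`uᵢ(u)` is complex).

## Main results

* `of_sub_sum_of_mem_relations`, `zsmul_of_sub_sum_of_mem_relations` — **finite integrand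
  additivity with an integer multiplier** in `KZ.relations`: if the representations `R i`, `i ∈ s`,
  live on the domain of `r` and `a · r.integrand = Σ_{i ∈ s} (R i).integrand` there (`a : ℤ`), then
  `a • [r] − Σ_{i ∈ s} [R i] ∈ KZ.relations`.  Pure calculus, reusable by every "trace identity"
  argument (Hecke correspondences here; the Landen/`T₂` identity of `DeltaRatioHecke`).
* `heckeIsMoves_halfArc_re`, `heckeIsMoves_halfArc_im` — for `T_p f = a f` with `a ∈ ℤ`,
  `g ∈ SL₂(ℤ)` and admissible half-arcs, `a • [re h(f ∣ g)] − Σ_{i ∈ I_p(N)} [re h((f ∣ βᵢ) ∣ g)]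
  ∈ KZ.relations` (and the same for imaginary parts).
* `heckeIsMoves_re`, `heckeIsMoves_im` — the full unimodular arc `{g0, g∞}` (`ρ : ModularSymbolRep f g`,
  classes `ρ.classRe`, `ρ.classIm`): `a • ρ.classRe − Σᵢ ([re h((f∣βᵢ)∣g)] − [re h((f∣βᵢ)∣gS)])
  ∈ KZ.relations`, i.e. `a_p·[arc, ω_f] − Σᵢ [βᵢ·arc, ω_f] ∈ KZ.relations` with `[βᵢ·arc, ω_f]`
  the canonical representation of `2πi ∫_{βᵢ g 0}^{βᵢ g ∞} f(z) dz`.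

For `p ∣ N` the index set `HeckeIdx N p` drops `β_∞` and the same statements are the `U_p`-relations.
The re-expansion of the image arcs `{βᵢg0, βᵢg∞}` (not unimodular) through unimodular symbols
(Manin's continued-fraction trick, Heilbronn matrices) is NOT part of this item: it is the zero-bulk
Stokes content of the route's `ManinStokes` / `ModularSectorCommensurability`.

Sources: F. Diamond, J. Shurman, *A First Course in Modular Forms* (2005), Prop. 5.2.1;
J. E. Cremona, *Algorithms for modular elliptic curves* (1997), §2.8 (2.8.7)–(2.8.8);
M. Kontsevich, D. Zagier, *Periods* (2001), §1.2 rule (1), §3.4.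
-/

noncomputable section

namespace Summit.KontsevichZagierPeriods.HeckeMultiplicityOne

open scoped MatrixGroups ModularForm
open CongruenceSubgroup Set MeasureTheory
open UpperHalfPlane hiding I
open Literature.NumberTheory.Transcendental Literature.NumberTheory.Transcendental.KZ
open Literature.NumberTheory.EllipticCurves.ModularForms

/-! ### Finite integrand additivity in the KZ calculus -/

section Calculus

variable {n : ℕ} {ι : Type*}

/-- Finite sums of `ℚ`-semialgebraic real functions on a `ℚ`-semialgebraic set are
`ℚ`-semialgebraic (two-term case `IsSemialgebraicFunOn.add_holds`, Bochnak–Coste–Roy Prop. 2.2.6,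
iterated; the empty sum is the polynomial `0`). [folklore] -/
theorem isSemialgebraicFunOn_finset_sum_of_forall (s : Finset ι) {σ : Set (Fin n → ℝ)}
    (hσ : Literature.ModelTheory.ExponentialFields.IsSemialgebraic ℚ σ) {F : ι → (Fin n → ℝ) → ℝ}
    (hF : ∀ i ∈ s, IsSemialgebraicFunOn ℚ σ (F i)) :
    IsSemialgebraicFunOn ℚ σ (fun x => ∑ i ∈ s, F i x) := by
  classical
  induction s using Finset.induction_on with
  | empty =>
    exact (isSemialgebraicFunOn_aeval hσ (0 : MvPolynomial (Fin n) ℚ)).congr fun x _ => by simp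
  | insert a s ha ih =>
    have h := IsSemialgebraicFunOn.add_holds (hF a (Finset.mem_insert_self a s))
      (ih fun i hi => hF i (Finset.mem_insert_of_mem hi))
    refine h.congr fun x _ => ?_
    simp [Finset.sum_insert ha]

/-- **Finite integrand additivity.** If the representations `R i` (`i ∈ s`) all have the domain of
`r` and `r.integrand = Σ_{i ∈ s} (R i).integrand` on it, then `[r] − Σ_{i ∈ s} [R i] ∈ KZ.relations`:
peel off one summand at a time by rule (1b) against the partial-sum representation (same domain,
integrand the partial sum — semialgebraic and integrable as a finite sum), the empty sum being the
zero representation, itself a relation (`of_zeroRep_mem_relations`).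
[cite: KontsevichZagier2001, §1.2 rule (1)] -/
theorem of_sub_sum_of_mem_relations (s : Finset ι) :
    ∀ (r : IntegralRep n) (R : ι → IntegralRep n), (∀ i ∈ s, (R i).domain = r.domain) →
      (∀ x ∈ r.domain, r.integrand x = ∑ i ∈ s, (R i).integrand x) →
      KZ.of r - ∑ i ∈ s, KZ.of (R i) ∈ relations := by
  classical
  induction s using Finset.induction_on with
  | empty =>
    intro r R _ he
    have h1 : Equivalent r (zeroRep r.domain r.isSemialgebraic_domain) :=
      equivalent_of_eqOn r (zeroRep r.domain r.isSemialgebraic_domain) rfl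
        fun x hx => by simpa [zeroRep] using he x hx
    have h2 := of_zeroRep_mem_relations r.domain r.isSemialgebraic_domain
    have h := relations.add_mem h1 h2
    rw [sub_add_cancel] at h
    simpa using h
  | insert a s ha ih =>
    intro r R hd he
    -- the partial-sum representation over `s`
    let r' : IntegralRep n :=
      { domain := r.domain
        integrand := fun x => ∑ i ∈ s, (R i).integrand x
        isSemialgebraic_domain := r.isSemialgebraic_domain
        isSemialgebraicFunOn_integrand :=
          isSemialgebraicFunOn_finset_sum_of_forall s r.isSemialgebraic_domain fun i hi => by
            rw [← hd i (Finset.mem_insert_of_mem hi)]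
            exact (R i).isSemialgebraicFunOn_integrand
        integrableOn :=
          integrable_finsetSum s fun i hi => by
            have h := (R i).integrableOn
            rw [hd i (Finset.mem_insert_of_mem hi)] at h
            exact h }
    have hstep : KZ.of r - KZ.of (R a) - KZ.of r' ∈ relations := by
      refine integrandAddRel_subset_relations ⟨n, r, R a, r', hd a (Finset.mem_insert_self a s),
        rfl, fun x hx => ?_, rfl⟩
      simp only [Pi.add_apply]
      rw [he x hx, Finset.sum_insert ha]
    have hrest : KZ.of r' - ∑ i ∈ s, KZ.of (R i) ∈ relations :=
      ih r' R (fun i hi => hd i (Finset.mem_insert_of_mem hi)) fun x _ => rfl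
    have h := relations.add_mem hstep hrest
    rw [Finset.sum_insert ha]
    convert h using 1
    abel

/-- **Integer scaling is integrand additivity** (`ℤ`-version of
`KZ.IntegralRep.of_constMul_nat_sub_nsmul_mem_relations`): for `a : ℤ`,
`[σ, a f] − a • [σ, f] ∈ KZ.relations`, where `[σ, a f] = r.constMul a`. For `a = k ≥ 0` this is the
natural-number lemma; for `a = −k` the representations `[σ, −k f]` and `[σ, k f]` have opposite
integrands and sum to a relation (`of_add_of_mem_relations_of_eqOn_neg`).
[cite: KontsevichZagier2001, §1.2 rule (1)] -/
theorem of_constMul_int_sub_zsmul_mem_relations (r : IntegralRep n) (a : ℤ) :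
    KZ.of (r.constMul (a : ℝ) (isAlgebraic_int a)) - a • KZ.of r ∈ relations := by
  obtain ⟨k, rfl | rfl⟩ := Int.eq_nat_or_neg a
  · -- `a = k`
    have h := r.of_constMul_nat_sub_nsmul_mem_relations k
    have e : r.constMul ((k : ℤ) : ℝ) (isAlgebraic_int (k : ℤ)) =
        r.constMul (k : ℝ) (isAlgebraic_nat k) := by
      congr 1
    rw [e, natCast_zsmul]
    exact h
  · -- `a = -k`
    have h := r.of_constMul_nat_sub_nsmul_mem_relations k
    have hneg : KZ.of (r.constMul (k : ℝ) (isAlgebraic_nat k)) +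
        KZ.of (r.constMul ((-(k : ℤ) : ℤ) : ℝ) (isAlgebraic_int (-(k : ℤ)))) ∈ relations := by
      refine of_add_of_mem_relations_of_eqOn_neg _ _ rfl fun x _ => ?_
      simp only [IntegralRep.integrand_constMul, Pi.neg_apply, Int.cast_neg, Int.cast_natCast]
      ring
    have h2 := relations.sub_mem hneg h
    rw [_root_.neg_smul, natCast_zsmul]
    convert h2 using 1
    abel

/-- **Finite integrand additivity with an integer multiplier.** If the representations `R i`
(`i ∈ s`) live on the domain of `r` and `a · r.integrand = Σ_{i ∈ s} (R i).integrand` there, with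
`a : ℤ`, then `a • [r] − Σ_{i ∈ s} [R i] ∈ KZ.relations`. This is the shape of every "trace
identity" argument in the calculus: a correspondence whose branches pull the integrand back to an
integer multiple of itself yields a relation, by rule (1b) alone.
[cite: KontsevichZagier2001, §1.2 rule (1)] -/
theorem zsmul_of_sub_sum_of_mem_relations (s : Finset ι) (r : IntegralRep n)
    (R : ι → IntegralRep n) (a : ℤ) (hd : ∀ i ∈ s, (R i).domain = r.domain)
    (he : ∀ x ∈ r.domain, (a : ℝ) * r.integrand x = ∑ i ∈ s, (R i).integrand x) :
    a • KZ.of r - ∑ i ∈ s, KZ.of (R i) ∈ relations := by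
  have h1 := of_sub_sum_of_mem_relations s (r.constMul (a : ℝ) (isAlgebraic_int a)) R hd
    fun x hx => by simpa using he x hx
  have h2 := of_constMul_int_sub_zsmul_mem_relations r a
  have h := relations.sub_mem h1 h2
  convert h using 1
  abel

end Calculus


/-! ### Admissibility of the Hecke translates: only semialgebraicity is at stake -/

section Admissible

variable {N : ℕ} [NeZero N]

/-- `(φ ∣ βᵢ) ∣ g = φ ∣ (βᵢ g)` for `g ∈ SL₂(ℤ)`: the Hecke translate of a translate is the slash
by ONE integer matrix of determinant `p`. [folklore] -/
theorem slash_heckeRep_slash_eq (φ : ℍ → ℂ) (k : ℤ) {p : ℕ} (hp : p ≠ 0) (i : Option (ZMod p))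
    (g : SL(2, ℤ)) :
    (φ ∣[k] intGL (heckeRep p i)) ∣[k] g =
      φ ∣[k] intGL (heckeRep p i * (g : Matrix (Fin 2) (Fin 2) ℤ)) := by
  have e : ((g : SL(2, ℤ)) : GL (Fin 2) ℝ) = intGL (g : Matrix (Fin 2) (Fin 2) ℤ) :=
    mapGL_eq_intGL g
  rw [ModularForm.SL_slash, e, ← SlashAction.slash_mul,
    ← intGL_mul (det_heckeRep_ne_zero hp i) (by simp)]

/-- **The Hecke translates of the half-arc integrands are cusp functions** (period `N p`): for
`f ∈ S₂(Γ₀(N))`, `(f ∣ βᵢ) ∣ g = f ∣ (βᵢ g)` with `βᵢ g` an integer matrix of determinant `p > 0`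
(`isCuspFunction_slash_intGL`). Hence their canonical integrands are absolutely integrable on
`(1728, ∞)` (`IsCuspFunction.integrableOn_arcIntegrand`). [folklore] -/
theorem isCuspFunction_slash_heckeRep_slash (f : CuspForm (Gamma0 N) 2) {p : ℕ} [NeZero p]
    (i : Option (ZMod p)) (g : SL(2, ℤ)) :
    IsCuspFunction ((N : ℝ) * p) ((⇑f ∣[(2 : ℤ)] intGL (heckeRep p i)) ∣[(2 : ℤ)] g) := by
  have hdet : (heckeRep p i * (g : Matrix (Fin 2) (Fin 2) ℤ)).det = p := by
    rw [Matrix.det_mul, det_heckeRep, Matrix.SpecialLinearGroup.det_coe, mul_one]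
  have hpos : 0 < (heckeRep p i * (g : Matrix (Fin 2) (Fin 2) ℤ)).det := by
    rw [hdet]; exact_mod_cast NeZero.pos p
  rw [slash_heckeRep_slash_eq _ _ (NeZero.ne p)]
  have h : IsCuspFunction ((N : ℝ) * ((heckeRep p i * (g : Matrix (Fin 2) (Fin 2) ℤ)).det : ℝ))
      (⇑f ∣[(2 : ℤ)] intGL (heckeRep p i * (g : Matrix (Fin 2) (Fin 2) ℤ))) :=
    isCuspFunction_slash_intGL (n := 0) f hpos
  rw [hdet, Int.cast_natCast] at h
  exact h

/-- **Admissibility of a Hecke translate reduces to semialgebraicity.** For `f ∈ S₂(Γ₀(N))`, the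
half-arc of `(f ∣ βᵢ) ∣ g` admits its canonical KZ representation as soon as the real and imaginary
parts of its canonical integrand are `ℚ`-semialgebraic on `(1728, ∞)` — integrability is automatic
(`isCuspFunction_slash_heckeRep_slash`). This is the shape of `HalfArcAdmissible.of_isCuspFunction` /
`ModularSymbolRep.of_hasRatCoeffs` for the translated arcs; the semialgebraicity itself (the
translate `(ω_f/dj)(βᵢg·) · d(j∘βᵢ)/dj` is algebraic over `ℚ(j)` through the modular equation
`Φ_p`) is the arithmetic input, kept as a hypothesis. [folklore] -/
theorem halfArcAdmissible_heckeTranslate (f : CuspForm (Gamma0 N) 2) {p : ℕ} [NeZero p]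
    (i : Option (ZMod p)) (g : SL(2, ℤ))
    (hre : IsSemialgebraicFunOn ℚ arcDomain fun x =>
      (arcIntegrand ((⇑f ∣[(2 : ℤ)] intGL (heckeRep p i)) ∣[(2 : ℤ)] g) (x 0)).re)
    (him : IsSemialgebraicFunOn ℚ arcDomain fun x =>
      (arcIntegrand ((⇑f ∣[(2 : ℤ)] intGL (heckeRep p i)) ∣[(2 : ℤ)] g) (x 0)).im) :
    HalfArcAdmissible ((⇑f ∣[(2 : ℤ)] intGL (heckeRep p i)) ∣[(2 : ℤ)] g) :=
  HalfArcAdmissible.of_isCuspFunction (isCuspFunction_slash_heckeRep_slash f i g) hre him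

end Admissible

/-! ### Hecke translates of a half-arc -/

section Hecke

variable {N : ℕ} [NeZero N]

/-- The pointwise Hecke trace identity, real parts: for `T_p f = a f` with `a ∈ ℤ`,
`a · re (arcIntegrand (f ∣ g) u) = Σᵢ re (arcIntegrand ((f ∣ βᵢ) ∣ g) u)` (from
`arcIntegrand_heckeT`, Diamond–Shurman Prop. 5.2.1). [cite: DiamondShurman2005, Prop. 5.2.1] -/
theorem arcIntegrand_heckeT_re (p : ℕ) [NeZero p] (hp : p.Prime) (f : CuspForm (Gamma0 N) 2)
    (a : ℤ) (hf : heckeT (Gamma0 N) 2 p f = (a : ℂ) • f) (g : SL(2, ℤ)) (u : ℝ) :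
    (a : ℝ) * (arcIntegrand (⇑f ∣[(2 : ℤ)] g) u).re =
      ∑ i : HeckeIdx N p,
        (arcIntegrand ((⇑f ∣[(2 : ℤ)] intGL (heckeRep p i.1)) ∣[(2 : ℤ)] g) u).re := by
  have h := congrArg Complex.re (arcIntegrand_heckeT p hp f hf g u)
  rw [Complex.re_sum] at h
  rw [← h]
  simp [Complex.mul_re]

/-- The pointwise Hecke trace identity, imaginary parts. [cite: DiamondShurman2005, Prop. 5.2.1] -/
theorem arcIntegrand_heckeT_im (p : ℕ) [NeZero p] (hp : p.Prime) (f : CuspForm (Gamma0 N) 2)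
    (a : ℤ) (hf : heckeT (Gamma0 N) 2 p f = (a : ℂ) • f) (g : SL(2, ℤ)) (u : ℝ) :
    (a : ℝ) * (arcIntegrand (⇑f ∣[(2 : ℤ)] g) u).im =
      ∑ i : HeckeIdx N p,
        (arcIntegrand ((⇑f ∣[(2 : ℤ)] intGL (heckeRep p i.1)) ∣[(2 : ℤ)] g) u).im := by
  have h := congrArg Complex.im (arcIntegrand_heckeT p hp f hf g u)
  rw [Complex.im_sum] at h
  rw [← h]
  simp [Complex.mul_im]

/-- **Hecke translates of a half-arc, real parts.** Let `T_p f = a f` with `a ∈ ℤ` (e.g. a newform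
with rational Fourier coefficients), `g ∈ SL₂(ℤ)`, and suppose the half-arc `g·{it | t > 1}` of `f`
and its `p + 1` (for `p ∣ N`: `p`) Hecke translates — the half-arcs of the cusp functions
`(f ∣ βᵢ) ∣ g`, `βᵢ ∈ {(1 j; 0 p)} ∪ {diag(p,1)}` — admit their canonical KZ representations. Then
`a • [re h(f ∣ g)] − Σᵢ [re h((f ∣ βᵢ) ∣ g)] ∈ KZ.relations`: all `p + 2` representations live on the
common domain `(1728, ∞)` and their integrands satisfy the pointwise trace identity
(`arcIntegrand_heckeT_re`), so this is finite integrand additivity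
(`zsmul_of_sub_sum_of_mem_relations`). [cite: DiamondShurman2005, Prop. 5.2.1] -/
theorem heckeIsMoves_halfArc_re (p : ℕ) [NeZero p] (hp : p.Prime) (f : CuspForm (Gamma0 N) 2)
    (a : ℤ) (hf : heckeT (Gamma0 N) 2 p f = (a : ℂ) • f) (g : SL(2, ℤ))
    (h : HalfArcAdmissible (⇑f ∣[(2 : ℤ)] g))
    (hi : ∀ i : HeckeIdx N p,
      HalfArcAdmissible ((⇑f ∣[(2 : ℤ)] intGL (heckeRep p i.1)) ∣[(2 : ℤ)] g)) :
    a • KZ.of (halfArcRepRe _ h) - ∑ i : HeckeIdx N p, KZ.of (halfArcRepRe _ (hi i)) ∈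
      relations :=
  zsmul_of_sub_sum_of_mem_relations Finset.univ (halfArcRepRe _ h)
    (fun i => halfArcRepRe _ (hi i)) a (fun _ _ => rfl)
    fun x _ => arcIntegrand_heckeT_re p hp f a hf g (x 0)

/-- **Hecke translates of a half-arc, imaginary parts** (as `heckeIsMoves_halfArc_re`).
[cite: DiamondShurman2005, Prop. 5.2.1] -/
theorem heckeIsMoves_halfArc_im (p : ℕ) [NeZero p] (hp : p.Prime) (f : CuspForm (Gamma0 N) 2)
    (a : ℤ) (hf : heckeT (Gamma0 N) 2 p f = (a : ℂ) • f) (g : SL(2, ℤ))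
    (h : HalfArcAdmissible (⇑f ∣[(2 : ℤ)] g))
    (hi : ∀ i : HeckeIdx N p,
      HalfArcAdmissible ((⇑f ∣[(2 : ℤ)] intGL (heckeRep p i.1)) ∣[(2 : ℤ)] g)) :
    a • KZ.of (halfArcRepIm _ h) - ∑ i : HeckeIdx N p, KZ.of (halfArcRepIm _ (hi i)) ∈
      relations :=
  zsmul_of_sub_sum_of_mem_relations Finset.univ (halfArcRepIm _ h)
    (fun i => halfArcRepIm _ (hi i)) a (fun _ _ => rfl)
    fun x _ => arcIntegrand_heckeT_im p hp f a hf g (x 0)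

/-! ### Hecke translates of a unimodular arc `{g0, g∞}` -/

/-- **Hecke correspondences are moves, real parts.** For `T_p f = a f` (`a ∈ ℤ`), `g ∈ SL₂(ℤ)`, the
canonical representation `ρ` of the modular symbol `⟨g⟩_f = 2πi ∫_{g0}^{g∞} f` (`ModularSymbolRep f g`,
class `ρ.classRe = [re h(f∣g)] − [re h(f∣gS)]`) and admissible Hecke translates of both half-arcs:
`a • ρ.classRe − Σᵢ ([re h((f∣βᵢ)∣g)] − [re h((f∣βᵢ)∣gS)]) ∈ KZ.relations`, i.e.
`a_p·[{g0,g∞}, ω_f] − Σᵢ [{βᵢg0, βᵢg∞}, ω_f] ∈ KZ.relations` with each image arc carried by its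
canonical (pulled-back) representation — the typed form of the route's informal item `HeckeIsMoves`
(Cremona (2.8.7): `T_p` on symbols is `Σᵢ βᵢ`, `βᵢ ∈ {(1 j; 0 p)} ∪ {diag(p,1)}`). Two instances of
`heckeIsMoves_halfArc_re`. [cite: CremonaAlgorithms1997, §2.8 (2.8.7)–(2.8.8)] -/
theorem heckeIsMoves_re (p : ℕ) [NeZero p] (hp : p.Prime) (f : CuspForm (Gamma0 N) 2)
    (a : ℤ) (hf : heckeT (Gamma0 N) 2 p f = (a : ℂ) • f) (g : SL(2, ℤ)) (ρ : ModularSymbolRep f g)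
    (hi : ∀ i : HeckeIdx N p,
      HalfArcAdmissible ((⇑f ∣[(2 : ℤ)] intGL (heckeRep p i.1)) ∣[(2 : ℤ)] g))
    (hi' : ∀ i : HeckeIdx N p,
      HalfArcAdmissible ((⇑f ∣[(2 : ℤ)] intGL (heckeRep p i.1)) ∣[(2 : ℤ)] (g * ModularGroup.S))) :
    a • ρ.classRe - ∑ i : HeckeIdx N p,
        (KZ.of (halfArcRepRe _ (hi i)) - KZ.of (halfArcRepRe _ (hi' i))) ∈ relations := by
  have h1 := heckeIsMoves_halfArc_re p hp f a hf g ρ.upper hi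
  have h2 := heckeIsMoves_halfArc_re p hp f a hf (g * ModularGroup.S) ρ.lower hi'
  have h := relations.sub_mem h1 h2
  rw [Finset.sum_sub_distrib, ModularSymbolRep.classRe, smul_sub]
  convert h using 1
  abel

/-- **Hecke correspondences are moves, imaginary parts** (as `heckeIsMoves_re`, with
`ρ.classIm = [im h(f∣g)] − [im h(f∣gS)]`). [cite: CremonaAlgorithms1997, §2.8 (2.8.7)–(2.8.8)] -/
theorem heckeIsMoves_im (p : ℕ) [NeZero p] (hp : p.Prime) (f : CuspForm (Gamma0 N) 2)
    (a : ℤ) (hf : heckeT (Gamma0 N) 2 p f = (a : ℂ) • f) (g : SL(2, ℤ)) (ρ : ModularSymbolRep f g)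
    (hi : ∀ i : HeckeIdx N p,
      HalfArcAdmissible ((⇑f ∣[(2 : ℤ)] intGL (heckeRep p i.1)) ∣[(2 : ℤ)] g))
    (hi' : ∀ i : HeckeIdx N p,
      HalfArcAdmissible ((⇑f ∣[(2 : ℤ)] intGL (heckeRep p i.1)) ∣[(2 : ℤ)] (g * ModularGroup.S))) :
    a • ρ.classIm - ∑ i : HeckeIdx N p,
        (KZ.of (halfArcRepIm _ (hi i)) - KZ.of (halfArcRepIm _ (hi' i))) ∈ relations := by
  have h1 := heckeIsMoves_halfArc_im p hp f a hf g ρ.upper hi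
  have h2 := heckeIsMoves_halfArc_im p hp f a hf (g * ModularGroup.S) ρ.lower hi'
  have h := relations.sub_mem h1 h2
  rw [Finset.sum_sub_distrib, ModularSymbolRep.classIm, smul_sub]
  convert h using 1
  abel

/-- **`HeckeIsMoves`, typed** — the closed statement offered to the route as the Lean form of item
stmt-KontsevichZagierPeriods-5125 (conjunction of `heckeIsMoves_re` and `heckeIsMoves_im`, all
binders explicit): for every level `N ≥ 1`, prime `p`, weight-2 cusp form `f` on `Γ₀(N)` with
`T_p f = a f`, `a ∈ ℤ`, every `g ∈ SL₂(ℤ)` whose symbol `⟨g⟩_f` admits its canonical KZ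
representation, and admissible Hecke translates of its two half-arcs,
`a • [re ⟨g⟩_f] − Σ_{i ∈ I_p(N)} [re ⟨βᵢ g⟩_f] ∈ KZ.relations` and likewise for imaginary parts,
where `[re ⟨βᵢ g⟩_f] = [re h((f∣βᵢ)∣g)] − [re h((f∣βᵢ)∣gS)]` is the canonical representation of the
image arc `{βᵢg0, βᵢg∞}`. [cite: CremonaAlgorithms1997, §2.8 (2.8.7)–(2.8.8)] -/
theorem heckeIsMoves :
    ∀ (N : ℕ) [NeZero N] (p : ℕ) [NeZero p], p.Prime → ∀ (f : CuspForm (Gamma0 N) 2) (a : ℤ),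
      heckeT (Gamma0 N) 2 p f = (a : ℂ) • f → ∀ (g : SL(2, ℤ)) (ρ : ModularSymbolRep f g)
      (hi : ∀ i : HeckeIdx N p,
        HalfArcAdmissible ((⇑f ∣[(2 : ℤ)] intGL (heckeRep p i.1)) ∣[(2 : ℤ)] g))
      (hi' : ∀ i : HeckeIdx N p,
        HalfArcAdmissible ((⇑f ∣[(2 : ℤ)] intGL (heckeRep p i.1)) ∣[(2 : ℤ)] (g * ModularGroup.S))),
      (a • ρ.classRe - ∑ i : HeckeIdx N p,
          (KZ.of (halfArcRepRe _ (hi i)) - KZ.of (halfArcRepRe _ (hi' i))) ∈ relations) ∧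
      (a • ρ.classIm - ∑ i : HeckeIdx N p,
          (KZ.of (halfArcRepIm _ (hi i)) - KZ.of (halfArcRepIm _ (hi' i))) ∈ relations) :=
  fun _ _ p _ hp f a hf g ρ hi hi' =>
    ⟨heckeIsMoves_re p hp f a hf g ρ hi hi', heckeIsMoves_im p hp f a hf g ρ hi hi'⟩

end Hecke

end Summit.KontsevichZagierPeriods.HeckeMultiplicityOne

end
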